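import Summits.ValiantsHypothesis.ValiantsHypothesis.Theorems.GrenetZeonDualUnipotentThreeHalvesHeavyTopInvariantFlag
import Summits.ValiantsHypothesis.ValiantsHypothesis.Theorems.GrenetZeonDualUnipotentThreeHalvesHeavyTopGradedFlag
import Summits.ValiantsHypothesis.ValiantsHypothesis.Theorems.GrenetZeonDualUnipotentThreeHalvesNilpotentPencilCore

/-!
# `GrenetZeon.DualUnipotentThreeHalves` (stmt-ValiantsHypothesis-24318), R2 `HeavyTopLaw` — PORT of val-idea-27's
# `Cruxes/DualUnipotentThreeHalves/WeightShadow.lean` @9b27f785c669 (cards «graded-shadow» / «pluecker-gap»), part (D): DEFINITIONS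

VERBATIM PORT (desk RULING #313 / director R282 (3); writer val-port-4 g2; AUTHOR OF THE MATHEMATICS AND THE LEAN TEXT:
val-idea-27 — every statement and proof below is idea-27's, byte-identical apart from the namespace
`…Theorems.GrenetZeon.WeightShadow` and added one-line docstrings where the source had none).  This file: the common weight vocabulary (`conj`, `wt`, `wtComp`, `wtFilt`, `pencilSpace`, `IsNilSpace`, `Certifies`, `gradingOp`, `IsGraded`, `IsGradedPencil`), the laws as `Prop`s (`GradedHeavyTopLaw`, `ThreeWeightLaw` — NOT asserted), the Plücker degree (`plDeg`, `PlUnstable`, `ShallowCertificatesDestabilise`) and MOR's `Irr₃` (`irrE`, `irrF`, `irrThreeSpace`).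

NOT ported (stay in `Cruxes/`): `stub_threeWeightLaw` (L4 = the law `ThreeWeightLaw`, research rung), the L1 appendix
(`gradedCertificate` over four linear-algebra stubs), the K1c-refuted section.  HONEST LABEL: helper-currency port of an
ideator's SORRY-FREE lemmas; nothing here bears on R2 `HeavyTopLaw`, 24318, S3b or 8062 beyond what the Cruxes file already
said; `VP ≠ VNP` is NOT proved; no summit statement is proved here.  No named facts.
-/

noncomputable section

-- single-conjunct layout: Sub = Summit, duplicated namespace component intended
set_option linter.dupNamespace false

namespace Summit.ValiantsHypothesis.ValiantsHypothesis.Theorems.GrenetZeon.WeightShadow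

open MvPolynomial Matrix
open scoped BigOperators
open Summit.ValiantsHypothesis.ValiantsHypothesis.Cruxes.TwoDimCoefficients.DimTwoCases (AffMat IsAffine)
open Summit.ValiantsHypothesis.ValiantsHypothesis.Theorems.GrenetZeon.RadicalSplit

variable {m : ℕ}

/-- Conjugation by a unit: `P M P⁻¹`. -/
def conj (P : (Matrix (Fin m) (Fin m) ℂ)ˣ) (M : Matrix (Fin m) (Fin m) ℂ) : Matrix (Fin m) (Fin m) ℂ :=
  (P : Matrix (Fin m) (Fin m) ℂ) * M * (↑P⁻¹ : Matrix (Fin m) (Fin m) ℂ)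

/-- Torus weight of the position `(i, j)` (the map `e_j ↦ e_i`) under `t ↦ diag(t^{lvl i})`:
positive = climbs (the convention of `flagCheap_of_weight_levels`: `hK` kills `lvl i < lvl j + c`). -/
def wt (lvl : Fin m → ℕ) (i j : Fin m) : ℤ := (lvl i : ℤ) - lvl j

/-- The weight-`d` homogeneous component of a matrix (in the conjugated basis). -/
def wtComp (lvl : Fin m → ℕ) (d : ℤ) (M : Matrix (Fin m) (Fin m) ℂ) : Matrix (Fin m) (Fin m) ℂ :=
  Matrix.of fun i j => if wt lvl i j = d then M i j else 0

/-- Matrices all of whose (conjugated) weights are `≥ d` — the `d`-th piece of the `λ`-FILTRATION of `M_m(ℂ)`. -/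
def wtFilt (P : (Matrix (Fin m) (Fin m) ℂ)ˣ) (lvl : Fin m → ℕ) (d : ℤ) : Submodule ℂ (Matrix (Fin m) (Fin m) ℂ) :=
  Submodule.span ℂ {M | ∀ i j : Fin m, wt lvl i j < d → conj P M i j = 0}

/-- The nilpotent linear space of the pencil: `W(N) = ℂ·N(0) + N_lin(ℂ^{n×n})`. -/
def pencilSpace {n : ℕ} (N : AffMat n m) : Submodule ℂ (Matrix (Fin m) (Fin m) ℂ) :=
  Submodule.span ℂ ({N.map (MvPolynomial.eval 0)} ∪ Set.range (linPart N))

/-- A linear space of nilpotent matrices. -/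
def IsNilSpace (W : Submodule ℂ (Matrix (Fin m) (Fin m) ℂ)) : Prop := ∀ X ∈ W, IsNilpotent X

/-- The data `(P, lvl; p, r, c, K)` is a UNIFORM WEIGHT CERTIFICATE for `N`: exactly the hypotheses of
✓ `flagCheap_of_weight_levels` (G″, p645496); val-idea-26's `WeightThin` (card krylov-seed) is its existential closure. -/
def Certifies {n : ℕ} (N : AffMat n m) (P : (Matrix (Fin m) (Fin m) ℂ)ˣ) (lvl : Fin m → ℕ) (p r c : ℕ)
    (K : Submodule ℂ (Fin n × Fin n → ℂ)) : Prop :=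
  1 ≤ c ∧ (∀ i, lvl i < p) ∧
  (∀ i j : Fin m, lvl i + r < lvl j →
    ((P : Matrix (Fin m) (Fin m) ℂ).map C * N * (↑P⁻¹ : Matrix (Fin m) (Fin m) ℂ).map C :
      Matrix (Fin m) (Fin m) (MvPolynomial (Fin n × Fin n) ℂ)) i j = 0) ∧
  (∀ v ∈ K, ∀ i j : Fin m, lvl i < lvl j + c → conj P (linPart N v) i j = 0) ∧
  ((p - 1 + r * (n - 1)) / (c + r) + 1) * n < Module.finrank ℂ K

/-- The semisimple GRADING OPERATOR `P⁻¹·diag(lvl)·P` of the cocharacter `(P, lvl)` (its weight spaces are the levels). -/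
def gradingOp (P : (Matrix (Fin m) (Fin m) ℂ)ˣ) (lvl : Fin m → ℕ) : Matrix (Fin m) (Fin m) ℂ :=
  conj P⁻¹ (Matrix.diagonal fun i => (lvl i : ℂ))

/-- The pencil space is GRADED by the cocharacter `(P, lvl)`: stable under taking weight components
(equivalently: `t ↦ P⁻¹ diag(t^{lvl}) P` lies in the stabiliser of `W(N)` in `GL_m`). -/
def IsGraded {n : ℕ} (N : AffMat n m) (P : (Matrix (Fin m) (Fin m) ℂ)ˣ) (lvl : Fin m → ℕ) : Prop :=
  ∀ M ∈ pencilSpace N, ∀ d : ℤ, conj P⁻¹ (wtComp lvl d (conj P M)) ∈ pencilSpace N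

/-- The AFFINE PENCIL is graded (critic V03 price P1: the torus must stabilise the top space `𝒯 = range (linPart N)`
AND the affine structure, not only `W = ℂ·N(0) + 𝒯`): weight components of tops are tops, and `N(0)` is homogeneous
(so `τ(t)·N(0)·τ(t)⁻¹ = t^{d₀} N(0)` — a rescaling, which changes no support / flag condition). -/
def IsGradedPencil {n : ℕ} (N : AffMat n m) (P : (Matrix (Fin m) (Fin m) ℂ)ˣ) (lvl : Fin m → ℕ) : Prop :=
  (∀ v : Fin n × Fin n → ℂ, ∀ d : ℤ, ∃ v' : Fin n × Fin n → ℂ,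
      conj P⁻¹ (wtComp lvl d (conj P (linPart N v))) = linPart N v') ∧
  (∃ d₀ : ℤ, wtComp lvl d₀ (conj P (N.map (MvPolynomial.eval 0))) = conj P (N.map (MvPolynomial.eval 0)))

/-- **GHTL — the torus-graded heavy-top law** (R2 restricted to pencils whose nilpotent space has a non-central
one-parameter symmetry).  Contains every heavy-top family of the census (L_k, B(a,b), MOR-inflations: 3 weights). -/
def GradedHeavyTopLaw : Prop :=
  ∃ C₀ n₀ : ℕ, ∀ n ≥ n₀, ∀ m : ℕ, C₀ * m ^ 2 < n ^ 3 → ∀ N : AffMat n m, IsAffine N → N ^ m = 0 →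
    (∃ (P : (Matrix (Fin m) (Fin m) ℂ)ˣ) (lvl : Fin m → ℕ), (∃ i j, lvl i ≠ lvl j) ∧ IsGradedPencil N P lvl) →
    (∀ K : Submodule ℂ (Fin n × Fin n → ℂ), RadOrth n m N K →
      Module.finrank ℂ K ≤ 16 * m * Nat.sqrt n + 16 * n) →
    FlagCheap n m N

/-- **FIRST LEMMA of `graded-shadow` (open rung): the THREE-WEIGHT graded heavy-top law.**  Three levels suffice to
contain L_k, B(a,b) and every MOR-inflation; the balanced class `{[[0,B],[C,0]]}` is its two-weight sub-case. -/
def ThreeWeightLaw : Prop :=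
  ∃ C₀ n₀ : ℕ, ∀ n ≥ n₀, ∀ m : ℕ, C₀ * m ^ 2 < n ^ 3 → ∀ N : AffMat n m, IsAffine N → N ^ m = 0 →
    (∃ (P : (Matrix (Fin m) (Fin m) ℂ)ˣ) (lvl : Fin m → ℕ),
      (∀ i, lvl i < 3) ∧ (∃ i j, lvl i ≠ lvl j) ∧ IsGradedPencil N P lvl) →
    (∀ K : Submodule ℂ (Fin n × Fin n → ℂ), RadOrth n m N K →
      Module.finrank ℂ K ≤ 16 * m * Nat.sqrt n + 16 * n) →
    FlagCheap n m N

/-- The **Plücker (Hilbert–Mumford) degree** of `W` along the cocharacter `(P, lvl)` (`p` levels):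
`Σ_X (lowest weight of X)` over a basis adapted to the `λ`-filtration, computed by Abel summation from the
filtration dimensions `f(d) = dim (W ⊓ wtFilt d)`.  `[W]` is `λ`-UNSTABLE iff this is `> 0`. -/
def plDeg (W : Submodule ℂ (Matrix (Fin m) (Fin m) ℂ)) (P : (Matrix (Fin m) (Fin m) ℂ)ˣ) (lvl : Fin m → ℕ)
    (p : ℕ) : ℤ :=
  (∑ d ∈ Finset.Icc (1 : ℤ) p, (Module.finrank ℂ ↥(W ⊓ wtFilt P lvl d) : ℤ)) -
    ∑ d ∈ Finset.Icc (1 - (p : ℤ)) 0,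
      ((Module.finrank ℂ W : ℤ) - (Module.finrank ℂ ↥(W ⊓ wtFilt P lvl d) : ℤ))

/-- `[W]` is Hilbert–Mumford UNSTABLE in the Plücker embedding of the Grassmannian (some cocharacter of `GL_m`
gives it positive degree); `¬ PlUnstable W` = SEMISTABLE (some `SL_m`-invariant of `Λ^D gl_m` is nonzero at `W`). -/
def PlUnstable (W : Submodule ℂ (Matrix (Fin m) (Fin m) ℂ)) : Prop :=
  ∃ (P : (Matrix (Fin m) (Fin m) ℂ)ˣ) (lvl : Fin m → ℕ) (p : ℕ), (∀ i, lvl i < p) ∧ 0 < plDeg W P lvl p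

/-- (K1c — REFUTED as typed, v1.7: `not_shallowCertificatesDestabilise` below, by the `Irr₃` pencil `f′ + x₀₀·e` and its
trivial one-level certificate `p = 1, r = 0, c = 1`) shallow certificates: does EVERY uniform weight certificate of a top-heavy
pencil space force `PlUnstable`?  NO.  K1b settles the DEEP range `p > r + c` positively; in the shallow range `p ≤ r + c` the
K1a bound only gives `plDeg ≥ n(p − r − c) ≥ −c·n`, and the certifying flag may be too coarse to carry any instability at all
(`p = 1`: certified iff `codim 𝒯 > n`, i.e. exactly at the top-heavy boundary `dim 𝒯 = n² − n − 1`, `N(0) ∉ 𝒯`), while `W`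
itself can be semistable (`Irr₃`, K2).  A format-restricted / `p ≥ 2` variant is not claimed either way. -/
def ShallowCertificatesDestabilise : Prop :=
  ∀ (n m : ℕ) (N : AffMat n m), IsAffine N → 2 ≤ n →
    ∀ (P : (Matrix (Fin m) (Fin m) ℂ)ˣ) (lvl : Fin m → ℕ) (p r c : ℕ) (K : Submodule ℂ (Fin n × Fin n → ℂ)),
      Certifies N P lvl p r c K → n ^ 2 ≤ Module.finrank ℂ (pencilSpace N) + n → PlUnstable (pencilSpace N)

/-- MOR's `Irr₃ = span{e = E₁₂+E₂₃, f′ = E₂₁−E₃₂}` (✓ `irrThree_nilpotent/irreducible`, p646307; same literals). -/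
def irrE : Matrix (Fin 3) (Fin 3) ℂ := !![0, 1, 0; 0, 0, 1; 0, 0, 0]

/-- `irrF` (val-idea-27, `WeightShadow.lean` @9b27f785c669; ported verbatim). -/
def irrF : Matrix (Fin 3) (Fin 3) ℂ := !![0, 0, 0; 1, 0, 0; 0, -1, 0]

/-- `irrThreeSpace` (val-idea-27, `WeightShadow.lean` @9b27f785c669; ported verbatim). -/
def irrThreeSpace : Submodule ℂ (Matrix (Fin 3) (Fin 3) ℂ) := Submodule.span ℂ {irrE, irrF}

end Summit.ValiantsHypothesis.ValiantsHypothesis.Theorems.GrenetZeon.WeightShadow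

end
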